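import Summits.BirchSwinnertonDyer.BirchSwinnertonDyer.Theorems.AlignedTransportAtTwoMainConjectureOfRankZeroBSDAtTwoCubicDoorsDeadSubcellClassNumberE
import Summits.BirchSwinnertonDyer.Rank1Residual.X5.TwoAdicInstancesToolkitB
import Literature.NumberTheory.CubicFields.CubicFieldDiscriminant7831ClassNumber
import HarnessLib

/-!
# Route `AlignedTransportAtTwo`, crux C2 `MainConjectureOfRankZeroBSDAtTwo` (stmt-BirchSwinnertonDyer-22298):
# THE SPLIT-STRATUM SEED `[1, 0, 1, −413, 3195]` (`N = 7831`): kernel-decided invariants, `Δ_min = −13163911 = −7831·41² ≡ 1 (mod 8)` (ON the Kilford stratum),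
# and its cubic `2`-torsion field `ℚ(β)` = the cubic field of discriminant `−7831` — class number SEVEN (`2` totally split, Dedekind-type, NO dyadic prime principal)

HONEST FRAMING (cell `bsd-f1-sign2`, WIDTH-5 attached prover seat `bsd-line-att-p3` gen 56 on line `birth` of the lead `bsd-line-att-p2`;
`--supports` stmt-BirchSwinnertonDyer-22298, closes nothing; BSD is NOT proved by any of this; the crux C2, its verdict «blocked-on
`Rank1Residual.GreenbergMuConjectureIrreducible`» and every registered stub are untouched).  THEOREMS ONLY (no `def`, no named fact, no instance, no `sorry`);
the curve is written LITERALLY; no Cremona label is asserted (names use `n<conductor>`).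

WHAT.  The W-data row (template: att-p4 g46 `…CubicSplitStratumSeedN17671`) for the LAST `r = 1` seed of the SPLIT stratum `Δ_min ≡ 1 (mod 8)` of the cell's
census (att-p3 g53 `CENSUS-SPLITDOOR-att-p3-g53.md`) that had no kernel row: the seed whose cubic field `ℚ(β)` (discriminant `−7831 = −41·191`) was filed as
«`h` even» (att-p4 g46: no principal dyadic prime) — in fact `h = 7` (this seat's `CubicFieldDiscriminant7831{,Primes,ClassNumber}`: `𝓞 = ℤ ⊕ ℤθ ⊕ ℤδ`,
`θ³ + 19θ + 12 = 0`, `δ = (θ² + θ)/2`, the dyadic primes `(2, 1+θ+δ)`, `(2, 1+δ)`, `(2, 2+θ)` two-generator of order `7`, every class `c⁷ = 1`).  Here: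
`Δ = −13163911`, `c₄ = 19801` (coprime ⟹ globally minimal), `#Ẽ(𝔽₂) = 2` (good ORDINARY at `2`, `a₂ = 1`), `b₂,b₄,b₆ = 1, −825, 12781`, `E[2]` irreducible (the
`u`-cubic has no root mod `5`), `Δ_min ≡ 1 (mod 8)` (`onKilfordStratumAtTwo_n7831`), `Δ < 0`, ★ `aeval_theta_n7831` (`θ = −(14/41)β² − (331/82)β + 7673/82` is a root of
`X³ + 19X + 12`), `finrank`, `discr = −7831`, ★ `pow_seven_eq_one_cubicField_n7831`, ★ `not_two_dvd_classNumber_cubicField_n7831`.  Consumed by this seat's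
layer-two general relation row `…CubicSplitStratumLayerTwoGeneralRelationRowN7831` (`μ₂ = 0`, `λ₂ ≤ 2` unconditional).  Nothing is asserted about `μ₂` or `MC₂` here.

References: [LMFDB] number field 3.1.7831.1, elliptic curves of conductor 7831; [Marcus2018] Ch. 3 Ex. 21, Ch. 5 Thm. 37; [SilvermanAEC2009] III.1, III.2.3, VII.1,
VII.5; [Serre1973] II §3.3; tree: att-p4 g46 `…CubicSplitStratumSeedN17671` (template), att-p5 g26 `…CubicKilfordPrimes`, this seat's `CubicFieldDiscriminant7831ClassNumber`.
-/

set_option linter.dupNamespace false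
set_option autoImplicit false

noncomputable section

open scoped Classical NumberField nonZeroDivisors IntermediateField

namespace Summit.BirchSwinnertonDyer.BirchSwinnertonDyer.Theorems.AlignedTransportAtTwoCubicSplitStratumSeedN7831

open NumberField IsDedekindDomain Polynomial WeierstrassCurve IntermediateField CongruenceSubgroup Module
  Literature.NumberTheory.IwasawaTheory Literature.NumberTheory.GaloisRepresentations
  Literature.NumberTheory.EllipticCurves Literature.NumberTheory.EllipticCurves.Greenberg1999
  Literature.NumberTheory.EllipticCurves.ModularForms Literature.NumberTheory.EllipticCurves.Rank1Residual
  Literature.NumberTheory.EllipticCurves.Module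
  Literature.NumberTheory.NumberFields Literature.NumberTheory.CubicFields
  Summit.BirchSwinnertonDyer.Rank1Residual Summit.BirchSwinnertonDyer.Rank1Residual.X1.MuLambda
  Summit.BirchSwinnertonDyer.Rank1Residual.X5 Summit.BirchSwinnertonDyer.Rank1Residual.X5.O1
  Summit.BirchSwinnertonDyer.Rank1Residual.X5.Instances Summit.BirchSwinnertonDyer.Rank1Residual.F1Sign2
  Summit.BirchSwinnertonDyer.BirchSwinnertonDyer.Theorems.Rank1ResidualX1Defs
  Summit.BirchSwinnertonDyer.BirchSwinnertonDyer.Theses.AlignedTransportAtTwo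
  Summit.BirchSwinnertonDyer.BirchSwinnertonDyer.Theorems.AlignedTransportAtTwoKilfordStratumShared
open Summit.BirchSwinnertonDyer.BirchSwinnertonDyer.Theorems.AlignedTransportAtTwoCubicKilfordPrimes (psi_gen_eq_zero)

/-! ## §0 The curve `⟨1, 0, 1, -413, 3195⟩` of conductor `7831` (rank 0) — kernel-decided invariants and its cubic field -/

/-- `Δ = -13163911 = −7831·41²`. [cite: SilvermanAEC2009, III.1] -/
theorem M7831_Δ : (⟨1, 0, 1, -413, 3195⟩ : WeierstrassCurve ℤ).Δ = -13163911 := by decide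

/-- `c₄ = 19801`. [cite: SilvermanAEC2009, III.1] -/
theorem M7831_c₄ : (⟨1, 0, 1, -413, 3195⟩ : WeierstrassCurve ℤ).c₄ = 19801 := by decide

/-- `⟨1, 0, 1, -413, 3195⟩` is an elliptic curve (`Δ = -13163911 ≠ 0`). [cite: SilvermanAEC2009, III.1] -/
theorem isElliptic_n7831 : ((⟨1, 0, 1, -413, 3195⟩ : WeierstrassCurve ℤ).baseChange ℚ).IsElliptic := by
  rw [WeierstrassCurve.isElliptic_iff, baseChange_int_Δ, M7831_Δ]; norm_num

/-- The model `⟨1, 0, 1, -413, 3195⟩` is globally minimal (`gcd(Δ, c₄) = 1`). [cite: SilvermanAEC2009, VII.1 Remark 1.1] -/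
theorem isGloballyMinimal_n7831 : ((⟨1, 0, 1, -413, 3195⟩ : WeierstrassCurve ℤ).baseChange ℚ).IsGloballyMinimal :=
  isGloballyMinimal_baseChange_int_of_gcd_eq_one 1 0 1 (-413) 3195 (by decide)

/-- `⟨1, 0, 1, -413, 3195⟩ mod 2` is `[1, 0, 1, 1, 1]`. [folklore] -/
theorem M7831_mod_two : (⟨1, 0, 1, -413, 3195⟩ : WeierstrassCurve ℤ).map (Int.castRingHom (ZMod 2)) = ⟨1, 0, 1, 1, 1⟩ := by
  ext <;> decide

/-- `#Ẽ(𝔽₂) = 2` for `⟨1, 0, 1, -413, 3195⟩` (`a₂ = 3 − 2 = 1`, odd). [cite: SilvermanAEC2009, V.2] -/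
theorem M7831_card_two :
    Nat.card ((⟨1, 0, 1, -413, 3195⟩ : WeierstrassCurve ℤ).map (Int.castRingHom (ZMod 2))).toAffine.Point = 2 := by
  rw [M7831_mod_two, natCard_point_eq_one_add_card _ (by decide)]; decide

/-- **`⟨1, 0, 1, -413, 3195⟩` has good ORDINARY reduction at `2`** (`2 ∤ Δ`, `#Ẽ(𝔽₂) = 2`, `a₂` odd). [cite: SilvermanAEC2009, VII.5 Prop. 5.1 (a)] -/
theorem goodOrd_two_n7831 [((⟨1, 0, 1, -413, 3195⟩ : WeierstrassCurve ℤ).baseChange ℚ).IsElliptic] [((⟨1, 0, 1, -413, 3195⟩ : WeierstrassCurve ℤ).baseChange ℚ).IsGloballyMinimal] : GoodOrd ((⟨1, 0, 1, -413, 3195⟩ : WeierstrassCurve ℤ).baseChange ℚ) 2 :=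
  Instances.goodOrd_two_baseChange_int_of_card_two _ (by rw [M7831_Δ]; decide) M7831_card_two

/-- The coefficients of `⟨1, 0, 1, -413, 3195⟩ / ℚ` (unfolded). [cite: SilvermanAEC2009, III.1] -/
theorem c7831_eq : ((⟨1, 0, 1, -413, 3195⟩ : WeierstrassCurve ℤ).baseChange ℚ) = ⟨1, 0, 1, -413, 3195⟩ := by
  rw [baseChange_int_eq]; norm_num

/-- `b₂, b₄, b₆` of `⟨1, 0, 1, -413, 3195⟩`: `1, -825, 12781`. [cite: SilvermanAEC2009, III.1] -/
theorem c7831_b : ((⟨1, 0, 1, -413, 3195⟩ : WeierstrassCurve ℤ).baseChange ℚ).b₂ = ((1 : ℤ) : ℚ) ∧ ((⟨1, 0, 1, -413, 3195⟩ : WeierstrassCurve ℤ).baseChange ℚ).b₄ = ((-825 : ℤ) : ℚ) ∧ ((⟨1, 0, 1, -413, 3195⟩ : WeierstrassCurve ℤ).baseChange ℚ).b₆ = ((12781 : ℤ) : ℚ) := by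
  rw [c7831_eq]; simp only [WeierstrassCurve.b₂, WeierstrassCurve.b₄, WeierstrassCurve.b₆]; norm_num

/-- **`E[2]` irreducible for `⟨1, 0, 1, -413, 3195⟩`**: the monic `u`-cubic `u³ + 1u² + -6600u + 204496` has no root modulo `5`.
[cite: SilvermanAEC2009, III.2.3 (b)] -/
theorem irr_two_n7831 [((⟨1, 0, 1, -413, 3195⟩ : WeierstrassCurve ℤ).baseChange ℚ).IsElliptic] : Irr ((⟨1, 0, 1, -413, 3195⟩ : WeierstrassCurve ℤ).baseChange ℚ) 2 :=
  irr_two_of_forall_cubic_ne _ c7831_b.1 c7831_b.2.1 c7831_b.2.2 (ℓ := 5) (by decide)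

/-- No rational `2`-torsion abscissa on `⟨1, 0, 1, -413, 3195⟩` (the route's `ht` binder). [cite: SilvermanAEC2009, III.2.3 (b)] -/
theorem not_hasRationalTwoTorsionX_n7831 [((⟨1, 0, 1, -413, 3195⟩ : WeierstrassCurve ℤ).baseChange ℚ).IsElliptic] : ∀ x : ℚ, ¬ HasRationalTwoTorsionX ((⟨1, 0, 1, -413, 3195⟩ : WeierstrassCurve ℤ).baseChange ℚ) x := by
  intro x hx
  exact (O1.irr_two_iff_not_exists_addOrderOf_eq_two _).mp irr_two_n7831 (exists_point_addOrderOf_eq_two hx)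

/-- `Δ_min = -13163911`. [cite: SilvermanAEC2009, VII.1] -/
theorem minimalDiscriminantInt_n7831 [((⟨1, 0, 1, -413, 3195⟩ : WeierstrassCurve ℤ).baseChange ℚ).IsGloballyMinimal] : ((⟨1, 0, 1, -413, 3195⟩ : WeierstrassCurve ℤ).baseChange ℚ).minimalDiscriminantInt = -13163911 := by
  rw [Instances.minimalDiscriminantInt_baseChange_int, M7831_Δ]

/-- `Δ_min = -13163911 ≡ 1 (mod 8)`: ON the Kilford (split) stratum — `2` splits completely in `ℚ(β)`. [cite: Serre1973, Ch. II §3.3 Thm. 4] -/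
theorem minimalDiscriminantInt_emod_eight_n7831 [((⟨1, 0, 1, -413, 3195⟩ : WeierstrassCurve ℤ).baseChange ℚ).IsGloballyMinimal] : ((⟨1, 0, 1, -413, 3195⟩ : WeierstrassCurve ℤ).baseChange ℚ).minimalDiscriminantInt % 8 = 1 := by
  rw [minimalDiscriminantInt_n7831]; decide

/-- **`⟨1, 0, 1, -413, 3195⟩` is ON the Kilford stratum.** [cite: Serre1973, Ch. II §3.3 Thm. 4] -/
theorem onKilfordStratumAtTwo_n7831 [((⟨1, 0, 1, -413, 3195⟩ : WeierstrassCurve ℤ).baseChange ℚ).IsElliptic] [((⟨1, 0, 1, -413, 3195⟩ : WeierstrassCurve ℤ).baseChange ℚ).IsGloballyMinimal] : OnKilfordStratumAtTwo ((⟨1, 0, 1, -413, 3195⟩ : WeierstrassCurve ℤ).baseChange ℚ) :=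
  (onKilfordStratumAtTwo_iff_minimalDiscriminantInt_emod_eight _ goodOrd_two_n7831).mpr minimalDiscriminantInt_emod_eight_n7831

/-- `Δ < 0` (`ℚ(β)` is a complex cubic field). [cite: SilvermanAEC2009, III.1] -/
theorem Δ_n7831_neg : ((⟨1, 0, 1, -413, 3195⟩ : WeierstrassCurve ℤ).baseChange ℚ).Δ < 0 := by
  rw [baseChange_int_Δ, M7831_Δ]; norm_num

/-- **`θ := −(14/41)g² − (331/82)g + 7673/82 = (30692 − 331u − 7u²)/328 ∈ ℚ(β)` (`g = β`) is a root of `f = X³ + 19X + 12`** (one `linear_combination` against `ψ_W(β) = 4β³ + 1β² + 2·(-825)β + (12781) = 0`;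
the multiplier is the exact quotient in `ℚ[β]`). [cite: LMFDB, number field 3.1.7831.1 (degree 3, discriminant −7831)] [cite: SilvermanAEC2009, III.1] -/
theorem aeval_theta_n7831 {β : AlgebraicClosure ℚ} (hβ : aeval β ((⟨1, 0, 1, -413, 3195⟩ : WeierstrassCurve ℤ).baseChange ℚ).twoTorsionPolynomial.toPoly = 0) :
    aeval ((-14 / 41 : ↥(IntermediateField.adjoin ℚ ({β} : Set (AlgebraicClosure ℚ)))) * (AdjoinSimple.gen ℚ β : ↥(IntermediateField.adjoin ℚ ({β} : Set (AlgebraicClosure ℚ)))) ^ 2 + (-331 / 82 : ↥(IntermediateField.adjoin ℚ ({β} : Set (AlgebraicClosure ℚ)))) * (AdjoinSimple.gen ℚ β : ↥(IntermediateField.adjoin ℚ ({β} : Set (AlgebraicClosure ℚ)))) + (7673 / 82 : ↥(IntermediateField.adjoin ℚ ({β} : Set (AlgebraicClosure ℚ))))) (MonicCubic.poly 0 19 12) = 0 := by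
  have hψ := psi_gen_eq_zero ((⟨1, 0, 1, -413, 3195⟩ : WeierstrassCurve ℤ).baseChange ℚ) hβ
  rw [c7831_b.1, c7831_b.2.1, c7831_b.2.2] at hψ
  set g : ↥(IntermediateField.adjoin ℚ ({β} : Set (AlgebraicClosure ℚ))) := AdjoinSimple.gen ℚ β with hg
  simp only [MonicCubic.poly, map_add, map_mul, map_pow, aeval_X, eq_intCast, map_intCast]
  push_cast at hψ ⊢
  linear_combination ((35422441 / 551368 : ↥(IntermediateField.adjoin ℚ ({β} : Set (AlgebraicClosure ℚ)))) * g ^ 0 + (-4543 / 551368 : ↥(IntermediateField.adjoin ℚ ({β} : Set (AlgebraicClosure ℚ)))) * g ^ 1 + (-24157 / 68921 : ↥(IntermediateField.adjoin ℚ ({β} : Set (AlgebraicClosure ℚ)))) * g ^ 2 + (-686 / 68921 : ↥(IntermediateField.adjoin ℚ ({β} : Set (AlgebraicClosure ℚ)))) * g ^ 3) * hψ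

/-- `[ℚ(β) : ℚ] = 3`. [cite: SilvermanAEC2009, III.2.3 (b)] -/
theorem finrank_cubicField_n7831 {β : AlgebraicClosure ℚ} (hβ : aeval β ((⟨1, 0, 1, -413, 3195⟩ : WeierstrassCurve ℤ).baseChange ℚ).twoTorsionPolynomial.toPoly = 0) :
    finrank ℚ ↥(IntermediateField.adjoin ℚ ({β} : Set (AlgebraicClosure ℚ))) = 3 := by
  haveI := isElliptic_n7831
  exact AddKatoTwo.finrank_adjoin_root_twoTorsionPolynomial_eq_three _
    (AlignedTransportAtTwoSeed.irr_two_of_forall_not_hasRationalTwoTorsionX _ not_hasRationalTwoTorsionX_n7831) hβ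

/-- **`d_{ℚ(β)} = −7831`**. [cite: LMFDB, number field 3.1.7831.1 (discriminant −7831)] -/
theorem discr_cubicField_n7831 {β : AlgebraicClosure ℚ} (hβ : aeval β ((⟨1, 0, 1, -413, 3195⟩ : WeierstrassCurve ℤ).baseChange ℚ).twoTorsionPolynomial.toPoly = 0) :
    (haveI : FiniteDimensional ℚ ↥(IntermediateField.adjoin ℚ ({β} : Set (AlgebraicClosure ℚ))) := IntermediateField.adjoin.finiteDimensional ((AlgebraicClosure.isAlgebraic ℚ).isAlgebraic β).isIntegral;
      haveI : NumberField ↥(IntermediateField.adjoin ℚ ({β} : Set (AlgebraicClosure ℚ))) := NumberField.mk;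
      NumberField.discr ↥(IntermediateField.adjoin ℚ ({β} : Set (AlgebraicClosure ℚ))) = -7831) := by
  haveI : FiniteDimensional ℚ ↥(IntermediateField.adjoin ℚ ({β} : Set (AlgebraicClosure ℚ))) := IntermediateField.adjoin.finiteDimensional ((AlgebraicClosure.isAlgebraic ℚ).isAlgebraic β).isIntegral
  haveI : NumberField ↥(IntermediateField.adjoin ℚ ({β} : Set (AlgebraicClosure ℚ))) := NumberField.mk
  exact CubicDisc7831.discr_eq (finrank_cubicField_n7831 hβ) (aeval_theta_n7831 hβ)

/-- ★ **`c⁷ = 1` for every ideal class of `ℚ(β)`** (`ℚ(β)` = the cubic field of discriminant `−7831`, class group `ℤ/7`: `CubicDisc7831.pow_seven_eq_one`). [cite: LMFDB, number field 3.1.7831.1 (class number 7)] -/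
theorem pow_seven_eq_one_cubicField_n7831 {β : AlgebraicClosure ℚ} (hβ : aeval β ((⟨1, 0, 1, -413, 3195⟩ : WeierstrassCurve ℤ).baseChange ℚ).twoTorsionPolynomial.toPoly = 0) :
    (haveI : FiniteDimensional ℚ ↥(IntermediateField.adjoin ℚ ({β} : Set (AlgebraicClosure ℚ))) := IntermediateField.adjoin.finiteDimensional ((AlgebraicClosure.isAlgebraic ℚ).isAlgebraic β).isIntegral;
      haveI : NumberField ↥(IntermediateField.adjoin ℚ ({β} : Set (AlgebraicClosure ℚ))) := NumberField.mk;
      ∀ c : ClassGroup (𝓞 ↥(IntermediateField.adjoin ℚ ({β} : Set (AlgebraicClosure ℚ)))), c ^ 7 = 1) := by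
  haveI : FiniteDimensional ℚ ↥(IntermediateField.adjoin ℚ ({β} : Set (AlgebraicClosure ℚ))) := IntermediateField.adjoin.finiteDimensional ((AlgebraicClosure.isAlgebraic ℚ).isAlgebraic β).isIntegral
  haveI : NumberField ↥(IntermediateField.adjoin ℚ ({β} : Set (AlgebraicClosure ℚ))) := NumberField.mk
  exact CubicDisc7831.pow_seven_eq_one (finrank_cubicField_n7831 hβ) (aeval_theta_n7831 hβ)

/-- ★ **`2 ∤ h(ℚ(β))`** (the doors' datum verbatim; here `h = 7`). [cite: LMFDB, number field 3.1.7831.1 (class number 7)] -/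
theorem not_two_dvd_classNumber_cubicField_n7831 {β : AlgebraicClosure ℚ} (hβ : aeval β ((⟨1, 0, 1, -413, 3195⟩ : WeierstrassCurve ℤ).baseChange ℚ).twoTorsionPolynomial.toPoly = 0) :
    (haveI : FiniteDimensional ℚ ↥(IntermediateField.adjoin ℚ ({β} : Set (AlgebraicClosure ℚ))) := IntermediateField.adjoin.finiteDimensional ((AlgebraicClosure.isAlgebraic ℚ).isAlgebraic β).isIntegral;
      haveI : NumberField ↥(IntermediateField.adjoin ℚ ({β} : Set (AlgebraicClosure ℚ))) := NumberField.mk;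
      ¬ 2 ∣ classNumber ↥(IntermediateField.adjoin ℚ ({β} : Set (AlgebraicClosure ℚ)))) := by
  haveI : FiniteDimensional ℚ ↥(IntermediateField.adjoin ℚ ({β} : Set (AlgebraicClosure ℚ))) := IntermediateField.adjoin.finiteDimensional ((AlgebraicClosure.isAlgebraic ℚ).isAlgebraic β).isIntegral
  haveI : NumberField ↥(IntermediateField.adjoin ℚ ({β} : Set (AlgebraicClosure ℚ))) := NumberField.mk
  exact CubicDisc7831.not_two_dvd_classNumber (finrank_cubicField_n7831 hβ) (aeval_theta_n7831 hβ)

end Summit.BirchSwinnertonDyer.BirchSwinnertonDyer.Theorems.AlignedTransportAtTwoCubicSplitStratumSeedN7831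

end
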